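import Literature.NumberTheory.EllipticCurves.TateModuleGaloisTransportProofs
import Literature.NumberTheory.EllipticCurves.GaloisActionProofs
import Literature.NumberTheory.EllipticCurves.Rank1Residual.Predicates
import Literature.NumberTheory.GaloisRepresentations.AbsGaloisOuterConj
import HarnessLib

/-!
# (sur) over `ℚ` ⟹ (irr_𝒦) over every quadratic field: the `hIrrK` binder of the covered
# irreducible rank-one rows is a THEOREM (cell `b2b-bsdres`, GLUE seat gen 7, ask A11)

HONEST FRAMING (cell `b2b-bsdres`, run/shared/lean/b2b/bsd-rank1-residual/, verbatim in every
file): the goal of the cell is to DELETE the COMBINATION-SHAPED residual classes of the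
Birch–Swinnerton-Dyer formula for ALL analytic-rank `≤ 1` elliptic curves over `ℚ` — "full BSD
formula for every rank `≤ 1` curve in class `C`" assembled STRICTLY from published theorems — so
that the rank-`≤ 1` remainder becomes exactly the CONSTRUCTION-SHAPED classes, which are TYPED
(missing-input `Prop`s), NOT attempted. This is not "finishing BSD". Nothing below is a class
theorem by itself; no named fact is introduced (THEOREMS ONLY, our own elementary work, hence
`Summits/` — as `X9/SurjBigImage.lean`).

## What this module proves

The covered irreducible rank-one rows of the partition (C2 = BCS 2025 Cor. 1.3.1, C3 = JSW 2017
Thm. 1.2.1, C16 = Yan–Zhu 2026 Thm. 4.15 at `p = 3`) consume the anticyclotomic control theorem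
(Jetchev–Skinner–Wan 2017 Thm. 3.3.1, `JetchevSkinnerWan2017.thm331_anticyclotomicControl`) and the
anticyclotomic main conjectures (BCS 2025 Thm. 1.2.4 (b), Yan–Zhu 2026 Thm. 4.12) at an imaginary
quadratic Heegner field `K`, and those facts carry the hypothesis **(irred_𝒦)**: "`E[p]` is an
irreducible `G_K`-module" = `(W.baseChange K).HasIrreducibleModPGaloisRep p`. Up to gen 6 of the
GLUE seat this was an EXPLICIT TYPED BINDER `hIrrK` of every class theorem and of the all-primes
capstones (`GLUE.md` §G6.2 (iv): "in print ⇐ (sur) for `p` split, BCS p. 4 / JSW; no tree bridge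
`geomTorsion W p ↔ geomTorsion (W.baseChange K) p`"). This file proves it from the row bit (sur):

* `exists_linearEquiv_map_ne_of_finrank_eq_two` (§1, linear algebra): in a plane over a field, a
  line `H` is moved by two linear automorphisms to lines different from `H` and from each other.
* `addSubgroup_eq_bot_or_top_of_stable_of_index_two` (§2, the orbit argument): if a group `Γ` acts
  on a plane `V` over `𝔽_p` through ALL of `Aut(V)` and `N ≤ Γ` has index `2`, then `V` has no
  `N`-stable line (the `Γ`-orbit of an `N`-stable line has at most `[Γ : N] = 2` members, but
  `Aut(V)` moves a line to at least three lines).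
* `hasIrreducibleModPGaloisRep_baseChange_of_hasSurjectiveModNGaloisRep` (§3): for an elliptic
  curve `W` over a field `F` of characteristic `0`, a prime `p` with `ρ̄_{E,p} : Γ_F → Aut(E[p])`
  SURJECTIVE and an extension `L/F` of degree `2`, `E[p]` is an irreducible `Γ_L`-module — through
  the tree's equivariant identification `E(F̄) ≃ E_L(L̄)` along `res : Γ_L → Γ_F`
  (`WeierstrassCurve.exists_addEquiv_geomPoints_baseChange`) and `[Γ_F : res(Γ_L)] = [L : F] = 2`
  (`absGaloisQuot`, onto with kernel `res(Γ_L)`).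
* `irrK_of_surj` (§4): the cell-level form — `Surj W p →` (`K` a number field with `[K : ℚ] = 2`)
  `→ (W.baseChange K).HasIrreducibleModPGaloisRep p`, EVERY prime `p` (the `hIrrK` binder of
  `bsdp_of_covered_of_mainConjectures_allPrimes_of_thm331[…]` is discharged from it in
  `Partition/MainConjecturesCoveredAllPrimesPublished.lean`).

References: J.-P. Serre, Invent. Math. 15 (1972) §2 (subgroups of `GL₂(𝔽_p)`); the use of
(irred_𝒦) ⇐ (sur): Burungale–Castella–Skinner, IMRN 2025, proof of Cor. 1.3.1 (p. 4);
Jetchev–Skinner–Wan, Camb. J. Math. 5 (2017) §7.4.1 (p. 30, "(irred_𝒦) is an easy consequence …");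
HOME/b2b-bsdres-lit-glue/GLUE.md GEN 6 §G6.4 A11, GEN 7 ADDENDUM.
-/

set_option autoImplicit false

noncomputable section

open scoped Classical

open WeierstrassCurve Field Literature.NumberTheory.EllipticCurves
  Literature.NumberTheory.EllipticCurves.Rank1Residual Literature.NumberTheory.GaloisRepresentations

universe u

namespace Summit.BirchSwinnertonDyer.Rank1Residual

/-! ### §1 Three lines in a plane moved apart by linear automorphisms -/

section Plane

variable {k : Type*} [Field k] {V : Type*} [AddCommGroup V] [Module k V]

/-- **In a plane, a line is moved by automorphisms to two further, distinct lines.** If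
`dim_k V = 2` and `H ≤ V` is a subspace with `H ≠ 0, V`, there are linear automorphisms `φ₁, φ₂`
of `V` with `φ₁(H) ≠ H`, `φ₂(H) ≠ H`, `φ₁(H) ≠ φ₂(H)`: write `H = k·u`, pick `w ∉ H`, so `(u, w)` is a
basis, and take `φ₁ : u ↦ w, w ↦ u` and `φ₂ : u ↦ u + w, w ↦ w` (the lines `k·u`, `k·w`, `k·(u+w)`
are pairwise distinct). [folklore] -/
theorem exists_linearEquiv_map_ne_of_finrank_eq_two (h2 : Module.finrank k V = 2)
    (H : Submodule k V) (h0 : H ≠ ⊥) (h1 : H ≠ ⊤) :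
    ∃ φ₁ φ₂ : V ≃ₗ[k] V, H.map (φ₁ : V →ₗ[k] V) ≠ H ∧ H.map (φ₂ : V →ₗ[k] V) ≠ H ∧
      H.map (φ₁ : V →ₗ[k] V) ≠ H.map (φ₂ : V →ₗ[k] V) := by
  haveI : Module.Finite k V := Module.finite_of_finrank_eq_succ h2
  -- a non-zero `u ∈ H` and some `w ∉ H`
  obtain ⟨u, huH, hu0⟩ := Submodule.exists_mem_ne_zero_of_ne_bot h0
  obtain ⟨w, hwH⟩ : ∃ w : V, w ∉ H := not_forall.mp (mt Submodule.eq_top_iff'.mpr h1)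
  -- `H = k·u` (both have dimension one)
  have hHu : (k ∙ u) = H := by
    refine Submodule.eq_of_le_of_finrank_eq ((Submodule.span_singleton_le_iff_mem u H).mpr huH) ?_
    have hlt : Module.finrank k H < 2 := h2 ▸ Submodule.finrank_lt h1
    have hne : Module.finrank k H ≠ 0 := fun h ↦ h0 (Submodule.finrank_eq_zero.mp h)
    rw [finrank_span_singleton hu0]
    omega
  -- the three bases `(u, w)`, `(w, u)`, `(u + w, w)`
  have hw_of_smul : ∀ a : k, a • u ≠ w := fun a h ↦ hwH (hHu ▸ Submodule.mem_span_singleton.mpr ⟨a, h⟩)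
  have hli₀ : LinearIndependent k ![u, w] := (LinearIndependent.pair_iff' hu0).mpr hw_of_smul
  have hw0 : w ≠ 0 := fun h ↦ hwH (h ▸ H.zero_mem)
  have hli₁ : LinearIndependent k ![w, u] := LinearIndependent.pair_symm_iff.mp hli₀
  have huw0 : u + w ≠ 0 := fun h ↦ hwH (by
    have : w = (-1 : k) • u := by rw [neg_one_smul]; exact (neg_eq_of_add_eq_zero_right h).symm
    exact hHu ▸ Submodule.mem_span_singleton.mpr ⟨-1, this.symm⟩)
  have hli₂ : LinearIndependent k ![u + w, w] := by
    refine (LinearIndependent.pair_iff' huw0).mpr fun a h ↦ ?_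
    -- `a • (u + w) = w` gives `a • u = (1 - a) • w`; if `a = 1` then `u = 0`, else `w ∈ k·u`
    have h' : a • u = (1 - a) • w := by
      rw [smul_add] at h
      rw [sub_smul, one_smul, eq_sub_iff_add_eq]
      exact h
    by_cases ha : a = 1
    · rw [ha, one_smul, sub_self, zero_smul] at h'
      exact hu0 h'
    · apply hwH
      rw [← hHu, Submodule.mem_span_singleton]
      refine ⟨(1 - a)⁻¹ * a, ?_⟩
      rw [mul_smul, h', ← mul_smul, inv_mul_cancel₀ (sub_ne_zero.mpr (Ne.symm ha)), one_smul]
  have hcard : Fintype.card (Fin 2) = Module.finrank k V := by rw [Fintype.card_fin, h2]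
  let b₀ : Module.Basis (Fin 2) k V := basisOfLinearIndependentOfCardEqFinrank hli₀ hcard
  let b₁ : Module.Basis (Fin 2) k V := basisOfLinearIndependentOfCardEqFinrank hli₁ hcard
  let b₂ : Module.Basis (Fin 2) k V := basisOfLinearIndependentOfCardEqFinrank hli₂ hcard
  have hb₀0 : b₀ 0 = u := by simp [b₀]
  have hb₁0 : b₁ 0 = w := by simp [b₁]
  have hb₂0 : b₂ 0 = u + w := by simp [b₂]
  -- `φ₁ : u ↦ w`, `φ₂ : u ↦ u + w`
  let φ₁ : V ≃ₗ[k] V := b₀.equiv b₁ (Equiv.refl _)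
  let φ₂ : V ≃ₗ[k] V := b₀.equiv b₂ (Equiv.refl _)
  have hφ₁0 : φ₁ (b₀ 0) = b₁ 0 := by simp [φ₁]
  have hφ₂0 : φ₂ (b₀ 0) = b₂ 0 := by simp [φ₂]
  have hφ₁u : φ₁ u = w := by rw [← hb₁0, ← hφ₁0, hb₀0]
  have hφ₂u : φ₂ u = u + w := by rw [← hb₂0, ← hφ₂0, hb₀0]
  have hmap₁ : H.map (φ₁ : V →ₗ[k] V) = k ∙ w := by
    rw [← hHu, Submodule.map_span, Set.image_singleton, LinearEquiv.coe_coe, hφ₁u]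
  have hmap₂ : H.map (φ₂ : V →ₗ[k] V) = k ∙ (u + w) := by
    rw [← hHu, Submodule.map_span, Set.image_singleton, LinearEquiv.coe_coe, hφ₂u]
  refine ⟨φ₁, φ₂, ?_, ?_, ?_⟩
  · -- `k·w ≠ H`
    rw [hmap₁]
    intro h
    exact hwH (h ▸ Submodule.mem_span_singleton_self w)
  · -- `k·(u+w) ≠ H`
    rw [hmap₂]
    intro h
    have huw : u + w ∈ H := h ▸ Submodule.mem_span_singleton_self (u + w)
    exact hwH ((Submodule.add_mem_iff_right H huH).mp huw)
  · -- `k·w ≠ k·(u+w)`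
    rw [hmap₁, hmap₂]
    intro h
    have huw : u + w ∈ k ∙ w := h ▸ Submodule.mem_span_singleton_self (u + w)
    obtain ⟨c, hc⟩ := Submodule.mem_span_singleton.mp huw
    -- `u = (c - 1) • w`
    have hu : (c - 1) • w = u := by rw [sub_smul, one_smul, hc]; abel
    by_cases hc1 : c - 1 = 0
    · rw [hc1, zero_smul] at hu
      exact hu0 hu.symm
    · apply hwH
      rw [← hHu, Submodule.mem_span_singleton]
      exact ⟨(c - 1)⁻¹, by rw [← hu, ← mul_smul, inv_mul_cancel₀ hc1, one_smul]⟩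

end Plane

/-! ### §2 The orbit argument: no line is stable under an index-`2` subgroup acting through all of `Aut` -/

section Orbit

variable {Γ : Type*} [Group Γ] {V : Type*} [AddCommGroup V] [DistribMulAction Γ V]
  {p : ℕ} [Fact p.Prime] [Module (ZMod p) V]

/-- **No `N`-stable line for `[Γ : N] = 2` when `Γ ↠ Aut(V)`.** Let `Γ` act on a `2`-dimensional
`𝔽_p`-space `V` so that EVERY additive automorphism of `V` is the action of some element of `Γ`,
and let `N ≤ Γ` have index `2`. Then every `N`-stable additive subgroup `H ≤ V` is `0` or `V`.
Proof: were `H` a line, take `φ₁, φ₂` as in §1 realised by `σ₁, σ₂ ∈ Γ`; among `1, σ₁, σ₂` two lie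
in the same `N`-coset (`[Γ : N] = 2`): `σᵢ⁻¹σⱼ ∈ N` stabilises `H`, so `φⱼ(H) ⊆ φᵢ(H)`, hence `=`
(equal dimension) — contradicting §1. [folklore] -/
theorem addSubgroup_eq_bot_or_top_of_stable_of_index_two (h2 : Module.finrank (ZMod p) V = 2)
    (hsurj : ∀ φ : V ≃+ V, ∃ σ : Γ, ∀ v : V, σ • v = φ v)
    (N : Subgroup Γ) (hN : N.index = 2)
    (H : AddSubgroup V) (hH : ∀ σ ∈ N, ∀ v ∈ H, σ • v ∈ H) : H = ⊥ ∨ H = ⊤ := by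
  rcases eq_or_ne H ⊥ with hb | hb
  · exact Or.inl hb
  rcases eq_or_ne H ⊤ with ht | ht
  · exact Or.inr ht
  exfalso
  haveI : Module.Finite (ZMod p) V := Module.finite_of_finrank_eq_succ h2
  -- `H` as an `𝔽_p`-subspace
  set H' : Submodule (ZMod p) V := AddSubgroup.toZModSubmodule p H with hH'def
  have hmem : ∀ v : V, v ∈ H' ↔ v ∈ H := fun v ↦ AddSubgroup.mem_toZModSubmodule p
  have h0 : H' ≠ ⊥ := by
    intro h
    apply hb
    rw [eq_bot_iff]
    intro v hv
    have hv' : v ∈ H' := (hmem v).mpr hv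
    rw [h] at hv'
    exact (Submodule.mem_bot _).mp hv'
  have h1 : H' ≠ ⊤ := by
    intro h
    apply ht
    rw [eq_top_iff]
    intro v _
    exact (hmem v).mp (h ▸ Submodule.mem_top)
  obtain ⟨φ₁, φ₂, hne₁, hne₂, hne₁₂⟩ := exists_linearEquiv_map_ne_of_finrank_eq_two h2 H' h0 h1
  obtain ⟨σ₁, hσ₁⟩ := hsurj φ₁.toAddEquiv
  obtain ⟨σ₂, hσ₂⟩ := hsurj φ₂.toAddEquiv
  -- key step: `σ⁻¹ τ ∈ N` forces `ψ(H) = φ(H)` for `σ ↔ φ`, `τ ↔ ψ`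
  have key : ∀ (φ ψ : V ≃ₗ[ZMod p] V) (σ τ : Γ), (∀ v, σ • v = φ v) → (∀ v, τ • v = ψ v) →
      σ⁻¹ * τ ∈ N → H'.map (ψ : V →ₗ[ZMod p] V) = H'.map (φ : V →ₗ[ZMod p] V) := by
    intro φ ψ σ τ hσ hτ hστ
    have hle : H'.map (ψ : V →ₗ[ZMod p] V) ≤ H'.map (φ : V →ₗ[ZMod p] V) := by
      rintro _ ⟨v, hv, rfl⟩
      refine ⟨φ.symm (ψ v), ?_, by simp⟩
      have heq : φ.symm (ψ v) = (σ⁻¹ * τ) • v := by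
        apply φ.injective
        rw [LinearEquiv.apply_symm_apply, ← hσ, mul_smul, smul_inv_smul, hτ]
      change φ.symm (ψ v) ∈ H'
      rw [hmem, heq]
      exact hH _ hστ v ((hmem v).mp hv)
    refine Submodule.eq_of_le_of_finrank_eq hle ?_
    rw [LinearEquiv.finrank_map_eq, LinearEquiv.finrank_map_eq]
  have hid : ∀ v : V, (1 : Γ) • v = (LinearEquiv.refl (ZMod p) V) v := fun v ↦ by simp
  have hmap_id : H'.map ((LinearEquiv.refl (ZMod p) V : V ≃ₗ[ZMod p] V) : V →ₗ[ZMod p] V) = H' := by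
    rw [LinearEquiv.refl_toLinearMap, Submodule.map_id]
  by_cases h₁ : σ₁ ∈ N
  · -- `φ₁(H) = H`
    have h := key (LinearEquiv.refl (ZMod p) V) φ₁ 1 σ₁ hid (fun v ↦ hσ₁ v) (by simpa using h₁)
    rw [hmap_id] at h
    exact hne₁ h
  by_cases h₂ : σ₂ ∈ N
  · have h := key (LinearEquiv.refl (ZMod p) V) φ₂ 1 σ₂ hid (fun v ↦ hσ₂ v) (by simpa using h₂)
    rw [hmap_id] at h
    exact hne₂ h
  · -- `σ₁, σ₂ ∉ N`, so `σ₁⁻¹ σ₂ ∈ N` (index two) and `φ₂(H) = φ₁(H)`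
    have h12 : σ₁⁻¹ * σ₂ ∈ N :=
      (Subgroup.mul_mem_iff_of_index_two hN).mpr (iff_of_false (by rwa [inv_mem_iff]) h₂)
    exact hne₁₂ (key φ₁ φ₂ σ₁ σ₂ (fun v ↦ hσ₁ v) (fun v ↦ hσ₂ v) h12).symm

end Orbit

/-! ### §3 (sur) over `F` ⟹ (irr) over every quadratic extension of `F` -/

section BaseChange

variable {F : Type u} [Field F] [CharZero F] (W : WeierstrassCurve F) [W.IsElliptic]
  (L : Type u) [Field L] [Algebra F L] (p : ℕ) [Fact p.Prime]

/-- **Surjective mod-`p` image over `F` ⟹ irreducible over a quadratic extension.** For an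
elliptic curve `W/F` (`char F = 0`), a prime `p` with `ρ̄_{E,p} : Γ_F → Aut(E[p])` surjective, and
`L/F` of degree `2`, the `Γ_L`-module `E_L[p] = E(L̄)[p]` is irreducible. Proof: transport a
`Γ_L`-stable subgroup of `E_L[p]` along the equivariant `E(F̄) ≃ E_L(L̄)`
(`exists_addEquiv_geomPoints_baseChange`, restricted to `p`-torsion) to a `res(Γ_L)`-stable subgroup
of `E[p]`; `res(Γ_L) = ker(Γ_F ↠ Gal(L/F))` has index `[L:F] = 2`; `E[p]` is a plane over `𝔽_p`
(`#E[p] = p²`, Silverman AEC III.6.4(b)); conclude by §2. The classical remark "(sur) ⇒ (irred_𝒦)"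
used silently in BCS 2025 (proof of Cor. 1.3.1) and JSW 2017 (§7.4.1). [cite: Serre1972, §2]
[cite: SilvermanAEC2009, Cor. III.6.4(b)] -/
theorem hasIrreducibleModPGaloisRep_baseChange_of_hasSurjectiveModNGaloisRep
    (h2 : Module.finrank F L = 2) (hsurj : W.HasSurjectiveModNGaloisRep p) :
    (W.baseChange L).HasIrreducibleModPGaloisRep p := by
  have hp : p.Prime := Fact.out
  haveI : Module.Finite F L := Module.finite_of_finrank_eq_succ h2
  haveI : Algebra.IsQuadraticExtension F L := ⟨h2⟩
  -- `E(F̄) ≃ E_L(L̄)` equivariantly along `res : Γ_L → Γ_F`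
  obtain ⟨e, he⟩ := W.exists_addEquiv_geomPoints_baseChange L
  -- `N = res(Γ_L)` has index `2`
  set N : Subgroup (absoluteGaloisGroup F) := (absGaloisRestrict F L).range with hNdef
  have hN : N.index = 2 := by
    have hker : (absGaloisQuot F L).ker = N := by
      ext τ
      rw [MonoidHom.mem_ker]
      exact absGaloisQuot_eq_one_iff F L τ
    rw [← hker, Subgroup.index_ker, MonoidHom.range_eq_top.2 (absGaloisQuot_surjective F L),
      Subgroup.card_top, IsGalois.card_aut_eq_finrank, h2]
  -- `E[p]` is a plane over `𝔽_p`
  letI : Module (ZMod p) (geomTorsion W (p : ℤ)) := AddSubgroup.torsionBy.zmodModule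
  have hpF : ((p : ℕ) : AlgebraicClosure F) ≠ 0 := fun h0 ↦
    (Nat.cast_ne_zero.mpr hp.ne_zero : (p : F) ≠ 0) <| by
      apply (algebraMap F (AlgebraicClosure F)).injective
      rw [map_natCast, map_zero, h0]
  have hcard : Nat.card (geomTorsion W (p : ℤ)) = p ^ 2 :=
    card_torsionPoints_eq_sq_holds W (AlgebraicClosure F) (n := p) hpF
  haveI : Finite (geomTorsion W (p : ℤ)) :=
    Nat.finite_of_card_ne_zero (by rw [hcard]; exact pow_ne_zero 2 hp.ne_zero)
  haveI : Module.Finite (ZMod p) (geomTorsion W (p : ℤ)) := Module.Finite.of_finite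
  have h2V : Module.finrank (ZMod p) (geomTorsion W (p : ℤ)) = 2 := by
    have h := Module.natCard_eq_pow_finrank (K := ZMod p) (V := geomTorsion W (p : ℤ))
    rw [hcard, Nat.card_zmod] at h
    exact (Nat.pow_right_injective hp.two_le h).symm
  -- every additive automorphism of `E[p]` is some `σ ∈ Γ_F` (surjectivity of `ρ̄`)
  have hsurj' : ∀ φ : geomTorsion W (p : ℤ) ≃+ geomTorsion W (p : ℤ),
      ∃ σ : absoluteGaloisGroup F, ∀ v, σ • v = φ v := by
    intro φ
    obtain ⟨σ, hσ⟩ := hsurj (Multiplicative.ofAdd φ)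
    refine ⟨σ, fun v ↦ ?_⟩
    have h := congrArg (fun f ↦ (Multiplicative.toAdd f) v) hσ
    simpa only [galoisRepTorsion_apply, toAdd_ofAdd] using h
  -- restriction of `e` to `p`-torsion, a bijection `E[p] → E_L[p]`
  have hmem : ∀ T : geomTorsion W (p : ℤ), e T ∈ geomTorsion (W.baseChange L) (p : ℤ) := by
    intro T
    rw [AddSubgroup.torsionBy.nsmul_iff, ← map_nsmul, AddSubgroup.torsionBy.nsmul_iff.mp T.2,
      map_zero]
  let φ : geomTorsion W (p : ℤ) →+ geomTorsion (W.baseChange L) (p : ℤ) :=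
    AddMonoidHom.codRestrict ((e : W.geomPoints →+ (W.baseChange L).geomPoints).comp
      (geomTorsion W (p : ℤ)).subtype) (geomTorsion (W.baseChange L) (p : ℤ)) hmem
  have hφ : ∀ T, ((φ T : geomTorsion (W.baseChange L) (p : ℤ)) : (W.baseChange L).geomPoints) = e T :=
    fun T ↦ rfl
  have hφsurj : Function.Surjective φ := by
    intro S
    have hS : e.symm S ∈ geomTorsion W (p : ℤ) := by
      rw [AddSubgroup.torsionBy.nsmul_iff]
      apply e.injective
      rw [map_nsmul, AddEquiv.apply_symm_apply, map_zero]
      exact AddSubgroup.torsionBy.nsmul_iff.mp S.2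
    refine ⟨⟨e.symm S, hS⟩, Subtype.ext ?_⟩
    rw [hφ]
    exact e.apply_symm_apply S
  have hφsmul : ∀ (γ : absoluteGaloisGroup L) (T : geomTorsion W (p : ℤ)),
      φ (absGaloisRestrict F L γ • T) = γ • φ T := fun γ T ↦
    Subtype.ext (by
      rw [AddSubgroup.torsionBy.coe_smul, hφ, hφ, AddSubgroup.torsionBy.coe_smul]
      exact he γ T)
  -- a `Γ_L`-stable subgroup of `E_L[p]` pulls back to a `res(Γ_L)`-stable subgroup of `E[p]`
  unfold WeierstrassCurve.HasIrreducibleModPGaloisRep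
  intro H hH
  set H₀ : AddSubgroup (geomTorsion W (p : ℤ)) := H.comap φ with hH₀def
  have hH₀ : ∀ σ ∈ N, ∀ T ∈ H₀, σ • T ∈ H₀ := by
    rintro σ ⟨γ, rfl⟩ T hT
    rw [hH₀def, AddSubgroup.mem_comap] at hT ⊢
    have h := hH γ _ hT
    rw [← hφsmul γ T] at h
    exact h
  rcases addSubgroup_eq_bot_or_top_of_stable_of_index_two h2V hsurj' N hN H₀ hH₀ with h | h
  · left
    rw [eq_bot_iff]
    intro x hx
    obtain ⟨T, rfl⟩ := hφsurj x
    have hT : T ∈ H₀ := by rw [hH₀def, AddSubgroup.mem_comap]; exact hx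
    rw [h, AddSubgroup.mem_bot] at hT
    rw [hT, map_zero]
    exact AddSubgroup.zero_mem _
  · right
    rw [eq_top_iff]
    intro x _
    obtain ⟨T, rfl⟩ := hφsurj x
    have hT : T ∈ H₀ := by rw [h]; exact AddSubgroup.mem_top T
    rw [hH₀def, AddSubgroup.mem_comap] at hT
    exact hT

end BaseChange

/-! ### §4 The cell-level forms (`ℚ`, a quadratic number field `K`) -/

section Cell

variable (W : WeierstrassCurve ℚ) [W.IsElliptic] (p : ℕ) [Fact p.Prime]

/-- **(sur) ⟹ (irred_𝒦) for every quadratic number field `K`, every prime `p`.** For `E/ℚ` with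
`ρ̄_{E,p}` surjective (the census bit `Surj W p`) and `[K : ℚ] = 2`, `E[p]` is an irreducible
`G_K`-module (`(W.baseChange K).HasIrreducibleModPGaloisRep p`) — hypothesis (irred_𝒦) of
Jetchev–Skinner–Wan 2017 Thm. 3.3.1 / Yan–Zhu 2026 §4.5 at the Heegner fields of the covered
irreducible rank-one rows. [cite: JetchevSkinnerWan2017, §7.4.1 (p. 30)]
[cite: BurungaleCastellaSkinner2025, proof of Cor. 1.3.1 (p. 4)] -/
theorem irrK_of_surj (hsurj : Surj W p) (K : Type) [Field K] [NumberField K]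
    (h2 : Module.finrank ℚ K = 2) : (W.baseChange K).HasIrreducibleModPGaloisRep p :=
  hasIrreducibleModPGaloisRep_baseChange_of_hasSurjectiveModNGaloisRep W K p h2 hsurj

end Cell

end Summit.BirchSwinnertonDyer.Rank1Residual

end
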